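import Summits.BirchSwinnertonDyer.BirchSwinnertonDyer.Theorems.GenusKolyvaginAtTwoPowDvdShaCardAtTwoRTKolyvaginMinima
import Summits.BirchSwinnertonDyer.BirchSwinnertonDyer.Theorems.GenusKolyvaginAtTwoPowDvdShaCardAtTwoRTDeepPairChebotarev
import Literature.NumberTheory.EllipticCurves.NonvanishingTwistsWaldspurgerOfHoffsteinLuo
import HarnessLib

/-!
# Route `GenusKolyvaginAtTwo`, crux L_T `PowDvdShaCardAtTwoRT` (stmt-BirchSwinnertonDyer-23242), LINE 18 stub KS:
# KOLYVAGIN'S DEPTH MINIMA AT 2 WITH A MARGIN — over the supplier's class of Gross–Frobenius primes of index `≥ L + k`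

Seat `bsd-line-gk2-p2` g19 (PROVER seat 2/3, cell `bsd-f1-sign2`), `--supports 23242 --as helper`.  THEOREMS ONLY (no definition; the minima are
produced inside the proof by `sSup`); no `sorry`; standard axioms.  BSD is NOT proved by any of this; neither is the crux, nor stub KS, nor stub L.

WHY (memo `Cruxes/PowDvdShaCardAtTwoRT/Lines/plus-descent-drops-guard-gk2p2.md` §3–§4; LEAD g18 ruling (R2), STATUS 14:39Z: «take
`adm ℓ := Zhang–Kolyvagin ∧ L+1 ≤ index ∧ FrobEqFrobInfty` (MARGIN ONE) throughout KS (minima re-run, hswap, integrator)» — Kolyvagin's class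
is transverse at an own prime only when the prime's index exceeds the level, `JET.kolyvaginClass_mem_transverseKer_two`).  The swap engines of
LINE 18 work at Zhang–Kolyvagin primes carrying Gross's Frobenius condition AND a margin above the level `L` of the classes, and the swap loop
must START from a level attaining the minimum INSIDE that class.  LEAD g17's `exists_kolyvaginMinima` takes the minima over all index-`≥ L`
levels (margin `0`, Frobenius clause discarded).  This file re-runs it over the sub-class cut out by an arbitrary predicate `G` implied by
«index `≥ L + k` and `FrobEqFrobInfty W K (2^(L+k)) ℓ`» for a supplier-chosen margin `k`:
* §1 `exists_datum_mul_pow_zsmul_kolyvaginClass_ne_zero_margin` — LEAD's antitone step `…RTMinimaStep` with the new prime taken at margin `k`: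
  the signed pair Čebotarev WITH LEVEL SHIFT (gk2-p4 g19 `PlusDescent.infinite_kolyvaginPrime_localization_fullOrder_pair_deep`, applied to the
  pair `(c_L(d), c_L(d))`; separation from (NPh_{L+k}) by `hres_deep_of_nonPhantom`, the primes of `n` being odd of good reduction), then Gross's
  compatible datum at `nℓ` and Q2 at `λ` exactly as in LEAD's proof;
* §2 `exists_squarefree_card_primeFactors_kolyvagin_margin` — `r`-fold square-free products in the class exist (empty-family signed Q5R at
  level `2^(L+k)`);
* §3 **`exists_kolyvaginMinima_pred`** — minima `Mr` over the class: antitone, `Mr 0 = M₀`, `Mr r ≤ L`, clause (i) for all data at all levels of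
  the class, attainment in the class, and «a 2-primitive `R`-fold product in the class ⟹ `Mr R = 0`» — the `hmin`/`hmin'`/`hatt` inputs of the
  drops integrator `PlusDescent.exists_recordLevel_avoiding_of_deepSwap` (`…RTRecordClauseOfDeepSwap`) and the lower-bound clause of (P52rec[G])
  (`…RTTwinShaLaddersOfProp52RecordPred`).  `k = 0`, `G := True` is LEAD's theorem.
Namespace `…Theorems.GenusExact.RelaxedCount`.  Closes nothing.  BSD is NOT proved by any of this.

References: [McCallumLMS1991] §5 p. 285 (the `M_r`), Prop. 5.2, §3 Cor. 3.2, §4 Cor. 4.5; [GrossLMS1991] §3 (3.1)–(3.3), §4 (4.1), Prop. 6.2;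
[Kolyvagin1991StructureSha].
-/

set_option autoImplicit false
-- the Theorems namespace of this sub repeats the summit name by design (D-0017 nested layout)
set_option linter.dupNamespace false

noncomputable section

open scoped Classical

open Field NumberField IsDedekindDomain WeierstrassCurve Rat.HeightOneSpectrum
open Literature.NumberTheory.EllipticCurves
open Literature.NumberTheory.GaloisRepresentations
open Summit.BirchSwinnertonDyer.BirchSwinnertonDyer.Theses.GenusKolyvaginAtTwo (KolyvaginRelationAtTwo)
open Summit.BirchSwinnertonDyer.Rank1Residual (X11b.KolyvaginAssembly.discr_lt_neg_four JET.exists_compatible_data_of_grossCM)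
open Summit.BirchSwinnertonDyer.BirchSwinnertonDyer.Theorems.GenusExact.VisiblePairAtTwo
  (natCast_mem_primesEquiv_symm natCast_prime_mem_iff_eq exists_natCast_mem)

namespace Summit.BirchSwinnertonDyer.BirchSwinnertonDyer.Theorems.GenusExact.RelaxedCount

variable {K : Type} [Field K] [NumberField K]

/-! ## §1 The antitone step with a margin -/

/-- **`M_{r+1} ≤ M_r` in class currency, the new prime at MARGIN `k`** (McCallum §5 p. 285 with Cor. 3.2 / Cor. 4.5 at `2`): for a datum `d` at a
square-free product `n` of Zhang–Kolyvagin primes of index `≥ L` with `addOrderOf c_L(d) = 2^w`, `w ≥ 1`, there are a prime `ℓ ∤ n`,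
Zhang–Kolyvagin of index `≥ L + k` with `FrobEqFrobInfty W K (2^(L+k)) ℓ`, and a datum `d′` at `nℓ` with `2^(w−1)•c_L(d′) ≠ 0`.  LEAD g17's
`exists_datum_mul_pow_zsmul_kolyvaginClass_ne_zero` with the Čebotarev step replaced by gk2-p4's level-shifted pair Čebotarev
(`infinite_kolyvaginPrime_localization_fullOrder_pair_deep` on the pair `(c_L(d), c_L(d))`, separation from (NPh_{L+k}) by `hres_deep_of_nonPhantom`).
[cite: McCallumLMS1991, §3 Cor. 3.2, §4 Lemma 4.3, Prop. 4.4, Cor. 4.5; §5 p. 285] [cite: GrossLMS1991, §3 (3.1)–(3.3), Prop. 5.4, Prop. 6.2] -/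
theorem exists_datum_mul_pow_zsmul_kolyvaginClass_ne_zero_margin (W : WeierstrassCurve ℚ) [W.IsElliptic] [W.IsGloballyMinimal]
    [NeZero (W.conductorNorm ℤ)] (hQ2 : KolyvaginRelationAtTwo)
    (hcm : ¬ W.HasCM) (hΔ : W.Δ < 0) (hT : Odd W.tamagawaProduct)
    (hρ : ∀ m : ℕ, W.HasSurjectiveModNGaloisRep (2 ^ m : ℕ))
    (hK : IsImaginaryQuadratic K) (hodd : Odd (NumberField.discr K)) (h3 : NumberField.discr K ≠ -3)
    (hHe : SatisfiesHeegnerHypothesis (W.conductorNorm ℤ) K) (hns : ¬ IsSquare ((NumberField.discr K : ℚ) * -|W.Δ|))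
    (c : K ≃ₐ[ℚ] K) (hc : c ≠ 1)
    (Dt : ModularForms.ModularParametrizationData W (W.conductorNorm ℤ)) (β : ℤ) (ι : K →+* ℂ)
    {L : ℕ} (hL : 1 ≤ L) (k : ℕ)
    (hNPh : ∀ z : galH1Torsion (W.baseChange K) ((2 ^ (L + k) : ℕ) : ℤ),
      (∀ ρ' ∈ torsionFixing (W.baseChange K) ((2 ^ (L + k) : ℕ) : ℤ), h1Eval (W.baseChange K) ((2 ^ (L + k) : ℕ) : ℤ) z ρ' = 0) →
      (∀ w : HeightOneSpectrum (𝓞 K), z ∈ selmerLocalKer (W.baseChange K) (w.adicCompletion K) ((2 ^ (L + k) : ℕ) : ℤ)) → z = 0)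
    {n : ℕ} (hn : Squarefree n)
    (hnK : ∀ q ∈ n.primeFactors, Zhang2014.IsKolyvaginPrime (W.conductorNorm ℤ) W K 2 q ∧ L ≤ Zhang2014.kolyvaginIndex W 2 q)
    (d : KolyvaginHeegnerData Dt β ι n) {w : ℕ} (hw : 1 ≤ w)
    (hord : addOrderOf (d.kolyvaginClass Nat.prime_two L) = 2 ^ w) :
    ∃ (ℓ : ℕ) (d' : KolyvaginHeegnerData Dt β ι (n * ℓ)), ℓ.Prime ∧ ℓ ∉ n.primeFactors ∧
      Zhang2014.IsKolyvaginPrime (W.conductorNorm ℤ) W K 2 ℓ ∧ L + k ≤ Zhang2014.kolyvaginIndex W 2 ℓ ∧ FrobEqFrobInfty W K (2 ^ (L + k)) ℓ ∧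
      Squarefree (n * ℓ) ∧
      (∀ q ∈ (n * ℓ).primeFactors, Zhang2014.IsKolyvaginPrime (W.conductorNorm ℤ) W K 2 q ∧ L ≤ Zhang2014.kolyvaginIndex W 2 q) ∧
      ((2 ^ (w - 1) : ℕ) : ℤ) • d'.kolyvaginClass Nat.prime_two L ≠ 0 := by
  -- (LEAD g17's proof of `exists_datum_mul_pow_zsmul_kolyvaginClass_ne_zero`, with the level-shifted Čebotarev)
  have hn0 : n ≠ 0 := hn.ne_zero
  have h4 : NumberField.discr K ≠ -4 := fun h ↦ by
    rw [h] at hodd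
    exact (Int.not_even_iff_odd.mpr hodd) ⟨-2, by norm_num⟩
  have hD : NumberField.discr K < -4 := X11b.KolyvaginAssembly.discr_lt_neg_four hK ⟨h3, h4⟩
  have hsurj1 : W.HasSurjectiveModNGaloisRep ((2 : ℤ) ^ 1) := by exact_mod_cast hρ 1
  have hρ2 : W.HasSurjectiveModNGaloisRep 2 := by simpa using hρ 1
  set cls := d.kolyvaginClass Nat.prime_two L with hcls_def
  have hcls0 : cls ≠ 0 := PlusDescent.ne_zero_of_addOrderOf_eq_two_pow hw hord
  -- the sign of the class (Gross 5.4 at 2)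
  obtain ⟨hsgn, hτ⟩ := KolyvaginClassSign.sign_conjAct_kolyvaginClass_two hK h3 h4 hodd hHe hsurj1 c hc Dt β ι hn hL hnK d
  -- Selmer off `n` (Gross 6.2(1) at 2, odd Tamagawa)
  have hsel : ∀ w' : HeightOneSpectrum (𝓞 K), (n : 𝓞 K) ∉ w'.asIdeal →
      cls ∈ selmerLocalKer (W.baseChange K) (w'.adicCompletion K) ((2 ^ L : ℕ) : ℤ) := fun w' hw' ↦
    RankOneAtTwoOneDoor.kolyvaginClass_two_mem_selmerLocalKer_of_odd_tamagawaProduct W hρ hT K hK h3 h4 hHe Dt β ι L hn hnK d w' hw'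
  -- the places of `ℚ` under the prime factors of `n`: odd primes of good reduction
  set T : Finset (Place ℚ) :=
    n.primeFactors.attach.image (fun q ↦ (Sum.inr (primesEquiv.symm ⟨q.1, Nat.prime_of_mem_primeFactors q.2⟩) : Place ℚ)) with hT_def
  have hTdata : ∀ u ∈ T, ∃ (v : HeightOneSpectrum (𝓞 ℚ)) (q : ℕ), u = Sum.inr v ∧ q.Prime ∧ q ≠ 2 ∧ (q : 𝓞 ℚ) ∈ v.asIdeal ∧
      W.HasGoodReductionAt v := by
    intro u hu
    rw [hT_def, Finset.mem_image] at hu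
    obtain ⟨q, -, rfl⟩ := hu
    have hZK := (hnK q.1 q.2).1
    refine ⟨_, q.1, rfl, Nat.prime_of_mem_primeFactors q.2, hZK.2.2.2.1, natCast_mem_primesEquiv_symm _, ?_⟩
    refine Literature.NumberTheory.EllipticCurves.hasGoodReductionAt_of_not_dvd_conductorNorm W _ ?_
    rw [Equiv.apply_symm_apply]
    exact hZK.2.1
  -- a place of `K` not over `T` does not divide `n`
  have hoff : ∀ w' : HeightOneSpectrum (𝓞 K), (Sum.inr (w'.under (𝓞 ℚ)) : Place ℚ) ∉ T → (n : 𝓞 K) ∉ w'.asIdeal := by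
    intro w' hw'
    refine natCast_notMem_of_forall_primeFactors (K := K) hn w' fun q hq hqw ↦ hw' ?_
    have hqp : q.Prime := Nat.prime_of_mem_primeFactors hq
    have hunder : (q : 𝓞 ℚ) ∈ (w'.under (𝓞 ℚ)).asIdeal := by
      change (q : 𝓞 ℚ) ∈ w'.asIdeal.under (𝓞 ℚ)
      rw [Ideal.under_def, Ideal.mem_comap, map_natCast]
      exact hqw
    have heq : w'.under (𝓞 ℚ) = primesEquiv.symm ⟨q, hqp⟩ := (natCast_prime_mem_iff_eq hqp _).mp hunder
    rw [hT_def, Finset.mem_image]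
    exact ⟨⟨q, hq⟩, Finset.mem_attach _ _, by rw [heq]⟩
  -- separation at level `2^(L+k)` from (NPh_{L+k})
  have hres : ∀ a b : ℤ, (∀ ρ' ∈ torsionFixing (W.baseChange K) ((2 ^ (L + k) : ℕ) : ℤ),
      h1Eval (W.baseChange K) ((2 ^ (L + k) : ℕ) : ℤ)
        (torsionH1OfDvd (W.baseChange K) (natCast_pow_dvd_natCast_pow_add 2 L k) (a • cls + b • cls)) ρ' = 0) →
      a • cls + b • cls = 0 := fun a b hab ↦
    PlusDescent.hres_deep_of_nonPhantom W K hK hρ2 L k hNPh T hTdata cls cls (fun w' hw' ↦ hsel w' (hoff w' hw'))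
      (fun w' hw' ↦ hsel w' (hoff w' hw')) a b hab
  -- the level-shifted signed pair Čebotarev for `(cls, cls)`: full local order `2^w` at primes of index `≥ L + k`
  have hinf := PlusDescent.infinite_kolyvaginPrime_localization_fullOrder_pair_deep W K hcm hΔ hK hns hρ c hc L k hL cls cls hw hw hord hord
    hsgn hsgn hτ hτ hres
  -- a new prime `ℓ ∤ n`
  obtain ⟨ℓ, hℓmem, hℓn⟩ := hinf.exists_notMem_finset n.primeFactors
  obtain ⟨hFrob, hKol, hidx, hloc⟩ := hℓmem
  have hℓp : ℓ.Prime := hKol.1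
  have hidxL : L ≤ Zhang2014.kolyvaginIndex W 2 ℓ := le_trans (Nat.le_add_right L k) hidx
  have hℓdvd : ¬ ℓ ∣ n := fun h ↦ hℓn (Nat.mem_primeFactors.mpr ⟨hℓp, h, hn0⟩)
  have hsq : Squarefree (n * ℓ) :=
    (Nat.squarefree_mul ((Nat.Prime.coprime_iff_not_dvd hℓp).mpr hℓdvd).symm).mpr ⟨hn, hℓp.squarefree⟩
  have hall : ∀ q ∈ (n * ℓ).primeFactors, Zhang2014.IsKolyvaginPrime (W.conductorNorm ℤ) W K 2 q ∧
      L ≤ Zhang2014.kolyvaginIndex W 2 q := by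
    intro q hq
    rw [Nat.primeFactors_mul hn0 hℓp.ne_zero, Finset.mem_union] at hq
    rcases hq with hq | hq
    · exact hnK q hq
    · rw [hℓp.primeFactors, Finset.mem_singleton] at hq
      subst hq
      exact ⟨hKol, hidxL⟩
  -- a compatible datum at `nℓ` (Gross's CM construction)
  obtain ⟨dℓ, hdℓ⟩ := JET.exists_compatible_data_of_grossCM
    (phi_heegnerPointOfConductor_mem_range_map_ringClassField_holds (W.conductorNorm ℤ) W K) hK hD hHe 2 Dt β ι hn
    (fun q hq ↦ (hnK q hq).1) d
  obtain ⟨hσ, hS, hS', hemb⟩ := hdℓ ℓ hKol hℓn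
  set d' := dℓ ℓ hKol hℓn with hd'_def
  -- the place `λ ∋ ℓ` of `K` and the local orders there
  obtain ⟨v, hv⟩ := exists_natCast_mem (K := K) hℓp
  have hlocv : ∀ j : ℕ, ((2 ^ j : ℕ) : ℤ) • cls ∈ (W.baseChange K).torsionLocalKer (v.adicCompletion K) ((2 ^ L : ℕ) : ℤ) ↔ w ≤ j :=
    fun j ↦ (hloc v hv).1 j
  -- Q2 at `λ`: the order of `c_L(d′)` at `λ` is the order of `c_L(d)` at `λ`
  have hQ := hQ2 W hcm K hK h3 h4 hHe hρ Dt β ι L hL n ℓ hsq hℓp hℓdvd hall d d' hσ hS hS' hemb v hv (w - 1)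
  refine ⟨ℓ, d', hℓp, hℓn, hKol, hidx, hFrob, hsq, hall, fun h0 ↦ ?_⟩
  have hmem : ((2 ^ (w - 1) : ℕ) : ℤ) • d'.kolyvaginClass Nat.prime_two L ∈
      (W.baseChange K).torsionLocalKer (v.adicCompletion K) ((2 ^ L : ℕ) : ℤ) := by
    rw [h0]; exact AddSubgroup.zero_mem _
  have := (hlocv (w - 1)).mp (hQ.2.mp hmem)
  omega

/-! ## §2 Square-free products in the supplier's class -/

/-- **`r`-fold square-free products of Zhang–Kolyvagin primes of index `≥ L` satisfying `G` exist**, for every predicate `G` implied by «index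
`≥ L + k` and Gross's Frobenius condition at level `2^(L+k)`» (signed Q5R with the EMPTY family at level `2^(L+k)`; induct on `r`).
[cite: McCallumLMS1991, §3 Cor. 3.2] [cite: GrossLMS1991, §3 (3.1)–(3.3)] -/
theorem exists_squarefree_card_primeFactors_kolyvagin_margin (W : WeierstrassCurve ℚ) [W.IsElliptic] [W.IsGloballyMinimal]
    [NeZero (W.conductorNorm ℤ)]
    (hcm : ¬ W.HasCM) (hΔ : W.Δ < 0) (hρ : ∀ m : ℕ, W.HasSurjectiveModNGaloisRep (2 ^ m : ℕ))
    (hK : IsImaginaryQuadratic K) (hns : ¬ IsSquare ((NumberField.discr K : ℚ) * -|W.Δ|)) (c : K ≃ₐ[ℚ] K) (hc : c ≠ 1)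
    {L : ℕ} (hL : 1 ≤ L) (k : ℕ) (G : ℕ → Prop)
    (hG : ∀ q : ℕ, Zhang2014.IsKolyvaginPrime (W.conductorNorm ℤ) W K 2 q → L + k ≤ Zhang2014.kolyvaginIndex W 2 q →
      FrobEqFrobInfty W K (2 ^ (L + k)) q → G q) (r : ℕ) :
    ∃ n : ℕ, Squarefree n ∧ n.primeFactors.card = r ∧
      ∀ q ∈ n.primeFactors, (Zhang2014.IsKolyvaginPrime (W.conductorNorm ℤ) W K 2 q ∧ L ≤ Zhang2014.kolyvaginIndex W 2 q) ∧ G q := by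
  -- infinitely many primes of the class (signed Q5R with the empty family at level `2^(L+k)`)
  have hinf := equivariantChebotarevAtTwo_eigen_of_not_isSquare (W.conductorNorm ℤ) W hcm hΔ K hK hns hρ c hc (L + k) (by omega) 0 ![] ![]
    (fun i ↦ i.elim0) (fun i ↦ i.elim0) (fun i ↦ i.elim0) (fun _ _ i ↦ i.elim0)
    (fun a _ ↦ by simp) ![] (fun i ↦ i.elim0) ![] (fun i ↦ i.elim0)
  induction r with
  | zero => exact ⟨1, squarefree_one, by simp, by simp⟩
  | succ r ih =>
    obtain ⟨n, hn, hcard, hnK⟩ := ih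
    have hn0 : n ≠ 0 := hn.ne_zero
    obtain ⟨ℓ, hℓmem, hℓn⟩ := hinf.exists_notMem_finset n.primeFactors
    obtain ⟨hFr, hKol, hidx, -⟩ := hℓmem
    have hℓp : ℓ.Prime := hKol.1
    have hℓdvd : ¬ ℓ ∣ n := fun h ↦ hℓn (Nat.mem_primeFactors.mpr ⟨hℓp, h, hn0⟩)
    refine ⟨n * ℓ, (Nat.squarefree_mul ((Nat.Prime.coprime_iff_not_dvd hℓp).mpr hℓdvd).symm).mpr ⟨hn, hℓp.squarefree⟩, ?_, ?_⟩
    · rw [Nat.primeFactors_mul hn0 hℓp.ne_zero, hℓp.primeFactors, Finset.card_union_of_disjoint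
        (Finset.disjoint_singleton_right.mpr hℓn), hcard, Finset.card_singleton]
    · intro q hq
      rw [Nat.primeFactors_mul hn0 hℓp.ne_zero, Finset.mem_union] at hq
      rcases hq with hq | hq
      · exact hnK q hq
      · rw [hℓp.primeFactors, Finset.mem_singleton] at hq
        subst hq
        exact ⟨⟨hKol, le_trans (Nat.le_add_right L k) hidx⟩, hG q hKol hidx hFr⟩

/-! ## §3 The minima over the class -/

/-- **KOLYVAGIN'S DEPTH MINIMA AT `2` OVER THE SUPPLIER'S CLASS (margin `k`).**  Frame of L_T as in `exists_kolyvaginMinima` (`E/ℚ` globally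
minimal, non-CM, `Δ < 0`, odd Tamagawa product, `ρ_{E,2^∞}` onto; `K` imaginary quadratic, `d_K` odd `≠ −3`, Heegner, `d_K·(−|Δ|)` not a square;
`c ≠ 1`; Q2; a conductor-`1` datum with `2^{M₀} ∥ P(1)`; `L ≥ M₀ + 1`), (NPh) at level `2^(L+k)`, and a predicate `G` implied by «index
`≥ L + k` and `FrobEqFrobInfty W K (2^(L+k)) ℓ`».  THEN there are minima `Mr : ℕ → ℕ` over the class of square-free levels whose primes are
Zhang–Kolyvagin of index `≥ L` AND satisfy `G`, with: `Mr (j+1) ≤ Mr j`; `Mr 0 = M₀`; `Mr r ≤ L`; (i) `2^(L − Mr r)•c_L(e) = 0` for every datum at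
every depth-`r` level of the class; (ii) attainment in the class at every depth; (iii) a 2-primitive depth-`R` level of the class forces `Mr R = 0`.
(LEAD's proof verbatim over the class; the antitone step is §1.) [cite: McCallumLMS1991, §5 p. 285, Prop. 5.2, §4 Cor. 4.5]
[cite: GrossLMS1991, §3 (3.1)–(3.3), §4 (4.1), Prop. 6.2] -/
theorem exists_kolyvaginMinima_pred (W : WeierstrassCurve ℚ) [W.IsElliptic] [W.IsGloballyMinimal] [NeZero (W.conductorNorm ℤ)]
    (hQ2 : KolyvaginRelationAtTwo) (hcm : ¬ W.HasCM) (hΔ : W.Δ < 0) (hT : Odd W.tamagawaProduct)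
    (hρ : ∀ m : ℕ, W.HasSurjectiveModNGaloisRep (2 ^ m : ℕ))
    (hK : IsImaginaryQuadratic K) (hodd : Odd (NumberField.discr K)) (h3 : NumberField.discr K ≠ -3)
    (hHe : SatisfiesHeegnerHypothesis (W.conductorNorm ℤ) K) (hns : ¬ IsSquare ((NumberField.discr K : ℚ) * -|W.Δ|))
    (c : K ≃ₐ[ℚ] K) (hc : c ≠ 1)
    (Dt : ModularForms.ModularParametrizationData W (W.conductorNorm ℤ)) (β : ℤ) (ι : K →+* ℂ)
    (d₁ : KolyvaginHeegnerData Dt β ι 1) (M₀ : ℕ)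
    (hdiv : ∃ Q : (W.baseChange (ringClassField K ι 1)).toAffine.Point, ((2 ^ M₀ : ℕ) : ℤ) • Q = d₁.derivedPoint)
    (hndiv : ¬ ∃ Q : (W.baseChange (ringClassField K ι 1)).toAffine.Point, ((2 ^ (M₀ + 1) : ℕ) : ℤ) • Q = d₁.derivedPoint)
    {L : ℕ} (hML : M₀ + 1 ≤ L) (k : ℕ)
    (hNPh : ∀ z : galH1Torsion (W.baseChange K) ((2 ^ (L + k) : ℕ) : ℤ),
      (∀ ρ' ∈ torsionFixing (W.baseChange K) ((2 ^ (L + k) : ℕ) : ℤ), h1Eval (W.baseChange K) ((2 ^ (L + k) : ℕ) : ℤ) z ρ' = 0) →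
      (∀ w : HeightOneSpectrum (𝓞 K), z ∈ selmerLocalKer (W.baseChange K) (w.adicCompletion K) ((2 ^ (L + k) : ℕ) : ℤ)) → z = 0)
    (G : ℕ → Prop)
    (hG : ∀ q : ℕ, Zhang2014.IsKolyvaginPrime (W.conductorNorm ℤ) W K 2 q → L + k ≤ Zhang2014.kolyvaginIndex W 2 q →
      FrobEqFrobInfty W K (2 ^ (L + k)) q → G q) :
    ∃ Mr : ℕ → ℕ, (∀ j, Mr (j + 1) ≤ Mr j) ∧ Mr 0 = M₀ ∧ (∀ r, Mr r ≤ L) ∧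
      (∀ (r n : ℕ), Squarefree n → n.primeFactors.card = r →
        (∀ q ∈ n.primeFactors, (Zhang2014.IsKolyvaginPrime (W.conductorNorm ℤ) W K 2 q ∧ L ≤ Zhang2014.kolyvaginIndex W 2 q) ∧ G q) →
        ∀ e : KolyvaginHeegnerData Dt β ι n, ((2 ^ (L - Mr r) : ℕ) : ℤ) • e.kolyvaginClass Nat.prime_two L = 0) ∧
      (∀ r : ℕ, ∃ (n : ℕ) (d : KolyvaginHeegnerData Dt β ι n), Squarefree n ∧ n.primeFactors.card = r ∧
        (∀ q ∈ n.primeFactors, (Zhang2014.IsKolyvaginPrime (W.conductorNorm ℤ) W K 2 q ∧ L ≤ Zhang2014.kolyvaginIndex W 2 q) ∧ G q) ∧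
        addOrderOf (d.kolyvaginClass Nat.prime_two L) = 2 ^ (L - Mr r)) ∧
      (∀ (R n : ℕ), Squarefree n → n.primeFactors.card = R →
        (∀ q ∈ n.primeFactors, (Zhang2014.IsKolyvaginPrime (W.conductorNorm ℤ) W K 2 q ∧ L ≤ Zhang2014.kolyvaginIndex W 2 q) ∧ G q) →
        ∀ d : KolyvaginHeegnerData Dt β ι n, addOrderOf (d.kolyvaginClass Nat.prime_two L) = 2 ^ L → Mr R = 0) := by
  -- (LEAD g17's proof of `exists_kolyvaginMinima`, with the predicate `G` carried along)
  have hL : 1 ≤ L := by omega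
  have h4 : NumberField.discr K ≠ -4 := fun h ↦ by
    rw [h] at hodd
    exact (Int.not_even_iff_odd.mpr hodd) ⟨-2, by norm_num⟩
  have hD : NumberField.discr K < -4 := X11b.KolyvaginAssembly.discr_lt_neg_four hK ⟨h3, h4⟩
  have hsurj1 : W.HasSurjectiveModNGaloisRep ((2 : ℤ) ^ 1) := by exact_mod_cast hρ 1
  -- admissible products and the height sets
  let Adm : ℕ → ℕ → Prop := fun r n ↦ Squarefree n ∧ n.primeFactors.card = r ∧
    ∀ q ∈ n.primeFactors, (Zhang2014.IsKolyvaginPrime (W.conductorNorm ℤ) W K 2 q ∧ L ≤ Zhang2014.kolyvaginIndex W 2 q) ∧ G q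
  let H : ℕ → Set ℕ := fun r ↦ {h | ∃ (n : ℕ) (e : KolyvaginHeegnerData Dt β ι n), Adm r n ∧
    addOrderOf (e.kolyvaginClass Nat.prime_two L) = 2 ^ h}
  -- every class has order a power of two `≤ 2^L`
  have hpow : ∀ (n : ℕ) (e : KolyvaginHeegnerData Dt β ι n), ∃ h, h ≤ L ∧ addOrderOf (e.kolyvaginClass Nat.prime_two L) = 2 ^ h := by
    intro n e
    have hdvd : addOrderOf (e.kolyvaginClass Nat.prime_two L) ∣ 2 ^ L := by
      rw [addOrderOf_dvd_iff_nsmul_eq_zero, ← natCast_zsmul]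
      exact zsmul_discreteH1_torsion _ _
    obtain ⟨h, hhL, hh⟩ := (Nat.dvd_prime_pow Nat.prime_two).mp hdvd
    exact ⟨h, hhL, hh⟩
  have hbdd : ∀ r, BddAbove (H r) := fun r ↦ ⟨L, fun h ⟨n, e, _, hh⟩ ↦ by
    obtain ⟨h', hh'L, hh'⟩ := hpow n e
    rw [hh'] at hh
    exact (Nat.pow_right_injective le_rfl hh).symm ▸ hh'L⟩
  -- data exist at every admissible product, and admissible products of every size exist
  have hdata : ∀ n, Squarefree n → (∀ q ∈ n.primeFactors, (Zhang2014.IsKolyvaginPrime (W.conductorNorm ℤ) W K 2 q ∧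
      L ≤ Zhang2014.kolyvaginIndex W 2 q) ∧ G q) → Nonempty (KolyvaginHeegnerData Dt β ι n) := fun n hn hnK ↦
    BirchSwinnertonDyer.Theorems.nonempty_kolyvaginHeegnerData_of_grossCM
      (phi_heegnerPointOfConductor_mem_range_map_ringClassField_holds (W.conductorNorm ℤ) W K)
      (exists_generator_ringClassGalOver_holds (K := K)) hK hHe Dt β ι d₁.dvd_sq_sub hn (fun q hq ↦ (hnK q hq).1.1.2.2.2.2.1)
  have hne : ∀ r, (H r).Nonempty := by
    intro r
    obtain ⟨n, hn, hcard, hnK⟩ := exists_squarefree_card_primeFactors_kolyvagin_margin W hcm hΔ hρ hK hns c hc hL k G hG r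
    obtain ⟨e⟩ := hdata n hn hnK
    obtain ⟨h, -, hh⟩ := hpow n e
    exact ⟨h, n, e, ⟨hn, hcard, hnK⟩, hh⟩
  -- the maxima `Wr r := sSup (H r)` and the minima `Mr r := L − Wr r`
  let Wr : ℕ → ℕ := fun r ↦ sSup (H r)
  have hWmem : ∀ r, Wr r ∈ H r := fun r ↦ Nat.sSup_mem (hne r) (hbdd r)
  have hWle : ∀ r h, h ∈ H r → h ≤ Wr r := fun r h hh ↦ le_csSup (hbdd r) hh
  have hWL : ∀ r, Wr r ≤ L := fun r ↦ by
    obtain ⟨n, e, -, hh⟩ := hWmem r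
    obtain ⟨h', hh'L, hh'⟩ := hpow n e
    rw [hh'] at hh
    exact (Nat.pow_right_injective le_rfl hh) ▸ hh'L
  -- antitonicity of the minima = monotonicity of the maxima
  have hWmono : ∀ r, Wr r ≤ Wr (r + 1) := by
    intro r
    obtain ⟨n, d, ⟨hn, hcard, hnK⟩, hord⟩ := hWmem r
    rcases Nat.eq_zero_or_pos (Wr r) with h0 | hpos
    · rw [h0]; exact Nat.zero_le _
    obtain ⟨ℓ, d', hℓp, hℓn, hℓK, hℓi, hℓF, hsq, hall, hne0⟩ :=
      exists_datum_mul_pow_zsmul_kolyvaginClass_ne_zero_margin W hQ2 hcm hΔ hT hρ hK hodd h3 hHe hns c hc Dt β ι hL k hNPh hn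
        (fun q hq ↦ (hnK q hq).1) d hpos hord
    obtain ⟨h', -, hh'⟩ := hpow (n * ℓ) d'
    -- `h' ≥ Wr r`, else `2^(Wr r − 1) • c_L(d′) = 0`
    have hge : Wr r ≤ h' := by
      by_contra hlt
      have hlt' : h' < Wr r := Nat.lt_of_not_le hlt
      apply hne0
      have hdvd : addOrderOf (d'.kolyvaginClass Nat.prime_two L) ∣ 2 ^ (Wr r - 1) := by
        rw [hh']; exact pow_dvd_pow 2 (by omega)
      rw [natCast_zsmul]
      exact addOrderOf_dvd_iff_nsmul_eq_zero.mp hdvd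
    have hcard' : (n * ℓ).primeFactors.card = r + 1 := by
      rw [Nat.primeFactors_mul hn.ne_zero hℓp.ne_zero, hℓp.primeFactors,
        Finset.card_union_of_disjoint (Finset.disjoint_singleton_right.mpr hℓn), hcard, Finset.card_singleton]
    have hall' : ∀ q ∈ (n * ℓ).primeFactors, (Zhang2014.IsKolyvaginPrime (W.conductorNorm ℤ) W K 2 q ∧
        L ≤ Zhang2014.kolyvaginIndex W 2 q) ∧ G q := by
      intro q hq
      rw [Nat.primeFactors_mul hn.ne_zero hℓp.ne_zero, Finset.mem_union] at hq
      rcases hq with hq | hq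
      · exact hnK q hq
      · rw [hℓp.primeFactors, Finset.mem_singleton] at hq
        subst hq
        exact ⟨⟨hℓK, le_trans (Nat.le_add_right L k) hℓi⟩, hG q hℓK hℓi hℓF⟩
    exact hge.trans (hWle (r + 1) h' ⟨n * ℓ, d', ⟨hsq, hcard', hall'⟩, hh'⟩)
  -- `Wr 0 = L − M₀`: every conductor-`1` datum has `ord c_L = 2^(L − M₀)`
  have hone : ∀ e : KolyvaginHeegnerData Dt β ι 1, addOrderOf (e.kolyvaginClass Nat.prime_two L) = 2 ^ (L - M₀) := by
    intro e
    let fam : (m : ℕ) → m ∣ 1 → KolyvaginHeegnerData Dt β ι m := fun m hm ↦ (Nat.eq_one_of_dvd_one hm).symm ▸ e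
    have hfam : fam 1 dvd_rfl = e := rfl
    have hPe : e.derivedPoint = d₁.derivedPoint := derivedPoint_eq_of_conductor_one W d₁ e
    have h := PlusDescent.addOrderOf_kolyvaginClass_two_eq_pow_sub (Dt := Dt) (β := β) (ι := ι) hK hodd h3 hHe hsurj1 (n := 1) (M := L)
      squarefree_one (fun q hq ↦ by simp at hq) fam (k := M₀) (by omega)
      (by rw [hfam, hPe]; exact hdiv) (by rw [hfam, hPe]; exact hndiv)
    rwa [hfam] at h
  have hW0 : Wr 0 = L - M₀ := by
    apply le_antisymm
    · obtain ⟨n, e, ⟨hn, hcard, -⟩, hh⟩ := hWmem 0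
      have hn1 : n = 1 := by
        have hpf : n.primeFactors = ∅ := Finset.card_eq_zero.mp hcard
        rcases Nat.primeFactors_eq_empty.mp hpf with h | h
        · exact absurd h hn.ne_zero
        · exact h
      subst hn1
      rw [hone e] at hh
      exact (Nat.pow_right_injective le_rfl hh).symm.le
    · exact hWle 0 _ ⟨1, d₁, ⟨squarefree_one, by simp, by simp⟩, hone d₁⟩
  refine ⟨fun r ↦ L - Wr r, fun j ↦ ?_, ?_, fun r ↦ Nat.sub_le L _, ?_, ?_, ?_⟩
  · -- antitone
    show L - Wr (j + 1) ≤ L - Wr j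
    have := hWmono j
    omega
  · -- `Mr 0 = M₀`
    show L - Wr 0 = M₀
    rw [hW0]; omega
  · -- clause (i): every datum at every admissible `r`-fold product
    intro r n hn hcard hnK e
    obtain ⟨h, -, hh⟩ := hpow n e
    have hle : h ≤ Wr r := hWle r h ⟨n, e, ⟨hn, hcard, hnK⟩, hh⟩
    have hsub : L - (L - Wr r) = Wr r := Nat.sub_sub_self (hWL r)
    have hdvd : addOrderOf (e.kolyvaginClass Nat.prime_two L) ∣ 2 ^ Wr r := by rw [hh]; exact pow_dvd_pow 2 hle
    show ((2 ^ (L - (L - Wr r)) : ℕ) : ℤ) • e.kolyvaginClass Nat.prime_two L = 0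
    rw [hsub, natCast_zsmul]
    exact addOrderOf_dvd_iff_nsmul_eq_zero.mp hdvd
  · -- attainment
    intro r
    obtain ⟨n, d, ⟨hn, hcard, hnK⟩, hh⟩ := hWmem r
    exact ⟨n, d, hn, hcard, hnK, by rw [Nat.sub_sub_self (hWL r)]; exact hh⟩
  · -- a primitive admissible `R`-fold product forces `Mr R = 0`
    intro R n hn hcard hnK d hord
    have hle : L ≤ Wr R := hWle R L ⟨n, d, ⟨hn, hcard, hnK⟩, hord⟩
    show L - Wr R = 0
    omega

end Summit.BirchSwinnertonDyer.BirchSwinnertonDyer.Theorems.GenusExact.RelaxedCount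

end
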